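import Mathlib
import Summits.Ventures.HodgeRepro.PeriodCloserC7Stability

/-!
# PeriodCloserC7UnramifiedTwist — the common sign of the anticyclotomic twist at an inert prime (ROUTE-B §9.9 (f)) on
the model

Blind re-derivation cell `pub-hodge-repro`, seat night-2 (gen 3).  Target tree path
`lean/Summits/Ventures/HodgeRepro/PeriodCloserC7UnramifiedTwist.lean`.  Continues gen 1's `PeriodCloserC7Stability.lean`
(`LocalChar R`, `eps κ n ω ψ = ω(ϖ)^n · κ · 𝔤(ω, ψ)`, Kudla Prop 3.8 (ii) / (3.32)).

ROUTE-B §9.9 (f) («my analysis» on Kudla Prop 3.8 (i)/(ii)): the N2-compatible twists of the four lines by ONE finite-order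
anticyclotomic `ν` at an INERT prime `𝔮` «multiply the parities of the twisted lines by ONE common sign
`s(ν) = (−1)^n · ε_𝔮(½, ν♭, ψ_δ)`: at `𝔮` the `χ′_j` are unramified with `χ′_j(ϖ) = −1`, so Prop 3.8 (i)/(ii) give
`ε_𝔮(χ′_j ν♭, ψ_δ) = (χ′_j ν♭)(ϖ^{ν(ψ_δ)+n}) 𝔤(ν♭, ψ_δ) = (−1)^{ν(ψ_δ)+n} · ε_𝔮(½, ν♭, ψ_δ)`, independent of `j`; … at `𝔮`
itself (E3)_𝔮 survives».  On the model, with `χ` unramified (`χ.unit = 1`, so `(χ ρ).unit = ρ.unit` and the Gauss sum is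
`ρ`'s) and `χ(ϖ) = −1`:

* `eps_mul_of_unit_eq_one` — `ε(χ ρ) = χ(ϖ)^n · ε(ρ)` (the unramified factor pulls out of Prop 3.8 (ii));
* `eps_mul_of_unramified_symplectic` — `ε(χ ρ) = (−1)^n · ε(ρ)` (the common sign, independent of `j`);
* `eps_E3_of_unramified` — (E3) at `𝔮` for the four twisted lines: both sides are `((−1)^n ε(ρ))²`;
* `eps_ratio_of_unramified` — the ratio `ε(χ ρ) / ε(χ)` for `χ` with `ε(χ) = χ(ϖ)^{n₀}` (Prop 3.8 (i), `n₀ = ν(ψ)`) is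
  `(−1)^{n + n₀} · ε(ρ)`: the route's `s(ν)` with `ν(ψ_δ) = n₀`, `n = ν(ψ_δ) + c(ν♭)`.

**What this is not.**  `ε(χ) = χ(ϖ)^{n₀}` for unramified `χ` is Prop 3.8 (i) read on the model (a hypothesis here, not
the model's `eps`, which is the ramified formula); whether some `(𝔮, ν)` has `s(ν) = −1` is not computed (ROUTE-B §9.9 (f):
«NOT COMPUTED HERE»).  Nothing here says anything about the status of the Hodge conjecture for CM abelian varieties,
which is NOT proved.
-/

set_option autoImplicit false

noncomputable section

namespace Summit.Ventures.HodgeRepro.PeriodCloser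

namespace LocalChar

variable {R : Type} [CommRing R] [Fintype R]

/-- **The unramified factor pulls out**: for `χ` trivial on the units, `ε(χ ρ) = χ(ϖ)^n · ε(ρ)`. -/
theorem eps_mul_of_unit_eq_one (κ : ℂ) (n : ℕ) (χ ρ : LocalChar R) (ψ : AddChar R ℂ) (hχ : χ.unit = 1) :
    eps κ n (χ * ρ) ψ = χ.piVal ^ n * eps κ n ρ ψ := by
  unfold eps gauss
  rw [mul_unit, mul_piVal, hχ, one_mul, mul_pow]
  ring

/-- **The common sign** (ROUTE-B §9.9 (f)): for the unramified conjugate-symplectic `χ` (`χ(ϖ) = −1`),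
`ε(χ ρ) = (−1)^n · ε(ρ)` — independent of which of the four lines `χ` is. -/
theorem eps_mul_of_unramified_symplectic (κ : ℂ) (n : ℕ) (χ ρ : LocalChar R) (ψ : AddChar R ℂ)
    (hχ : χ.unit = 1) (hπ : χ.piVal = -1) : eps κ n (χ * ρ) ψ = (-1) ^ n * eps κ n ρ ψ := by
  rw [eps_mul_of_unit_eq_one κ n χ ρ ψ hχ, hπ]

/-- **(E3) at the inert twist prime survives**: if the four lines are unramified conjugate-symplectic at `𝔮`, the
twisted lines satisfy `ε(χ′_0 ρ) ε(χ′_1 ρ) = ε(χ′_2 ρ) ε(χ′_3 ρ)` — both sides are `((−1)^n ε(ρ))²`. -/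
theorem eps_E3_of_unramified (κ : ℂ) (n : ℕ) (χ' : Fin 4 → LocalChar R) (ρ : LocalChar R) (ψ : AddChar R ℂ)
    (hχ : ∀ j, (χ' j).unit = 1) (hπ : ∀ j, (χ' j).piVal = -1) :
    eps κ n (χ' 0 * ρ) ψ * eps κ n (χ' 1 * ρ) ψ = eps κ n (χ' 2 * ρ) ψ * eps κ n (χ' 3 * ρ) ψ := by
  rw [eps_mul_of_unramified_symplectic κ n (χ' 0) ρ ψ (hχ 0) (hπ 0),
    eps_mul_of_unramified_symplectic κ n (χ' 1) ρ ψ (hχ 1) (hπ 1),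
    eps_mul_of_unramified_symplectic κ n (χ' 2) ρ ψ (hχ 2) (hπ 2),
    eps_mul_of_unramified_symplectic κ n (χ' 3) ρ ψ (hχ 3) (hπ 3)]

/-- **The ratio `ε(χ ρ) / ε(χ)`** for the unramified `χ` with `ε(χ) = χ(ϖ)^{n₀}` (Kudla Prop 3.8 (i), `n₀ = ν(ψ)`) and
`χ(ϖ) = −1`: `(−1)^{n + n₀} · ε(ρ)` — the route's `s(ν)` (the twist multiplies every line's local sign by the same
number). -/
theorem eps_ratio_of_unramified (κ : ℂ) (n n₀ : ℕ) (χ ρ : LocalChar R) (ψ : AddChar R ℂ) (hχ : χ.unit = 1)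
    (hπ : χ.piVal = -1) (e₀ : ℂ) (he₀ : e₀ = χ.piVal ^ n₀) :
    eps κ n (χ * ρ) ψ = ((-1) ^ (n + n₀) * eps κ n ρ ψ) * e₀ := by
  rw [eps_mul_of_unramified_symplectic κ n χ ρ ψ hχ hπ, he₀, hπ, pow_add]
  have h2 : ((-1 : ℂ) ^ n₀) * (-1) ^ n₀ = 1 := by
    rw [← pow_add, ← two_mul, pow_mul, neg_one_sq, one_pow]
  linear_combination (-((-1 : ℂ) ^ n * eps κ n ρ ψ)) * h2

end LocalChar

end Summit.Ventures.HodgeRepro.PeriodCloser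

end
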